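import Mathlib
import Literature.Analysis.FluidPDE.ClassicalSolution
import Literature.Analysis.FluidPDE.VorticityCalculus
import Literature.Analysis.FluidPDE.AncientSimilarityVorticity
import Summits.NavierStokesRegularity.NavierStokesRegularity.Theorems.ThreadingFluxHorizonTowerDefs
import Summits.NavierStokesRegularity.NavierStokesRegularity.Theorems.ThreadingFluxLoopLawFirstLemmas
import HarnessLib

/-!
# Crux `PoloidalLiouville` (stmt-NavierStokesRegularity-1222, W1), crux idea «horizon-threading-tower» (ns-idea-15):
# THE ORDER-ONE HORIZON LAW, BLOW-DOWN FORM — `𝔏₁[U] ≡ 0` for every `C²` blow-down limit of an unthreaded slice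
# (the `𝔏₁` HALF of the sketch's `OrderTwoHorizonLawBlowdown`, unconditionally, with no homogeneity and no decay rate)

Support file (`--supports stmt-NavierStokesRegularity-1222`, helper).  Experiment cell `ns-wall-extremal`, width hand
ns-wall-eng-4 g4.  0 kit.  Vocabulary of the horizon card's Theorems-side twin `ThreadingFluxHorizonTowerDefs`
(`threadingFlux`, `horizonL1`, `IsBlowdownLimit`) and the Literature class `IsClassicalNSSolutionOn`.

## Statement (`HorizonTower.orderOneHorizonLawBlowdown`)

Let `(u, p)` be a classical Navier–Stokes solution (`ν = 1`, no force) on an OPEN set of times `S ∋ t₀`, unthreaded about `x₀`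
at every time of `S` (`threadingFlux u x₀ t x = 0`).  If the slice `u t₀` and the pressure `p t₀` have a blow-down limit
`(U, P₀)` about `x₀` (`IsBlowdownLimit (u t₀) (p t₀) x₀ U P₀`: `λₖ → ∞`, six derivatives of `u t₀ (x₀ + λₖ ·) − U` and two of the
pressure difference tend to `0` uniformly on compacts off `0`) with `U ∈ C²(ℝ³ ∖ {0})`, then
`horizonL1 U 0 y = ‖y‖ ⟪y, curl (U × curl U)(y)⟫ = 0` for every `y ≠ 0`.

Compare the sketch's `OrderTwoHorizonLawBlowdown` (`ThreadingFluxHorizonTowerDefs` l.189; labelled M–L, «the lever», not landed):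
it concludes `𝔏₁[U] ≡ 0 ∧ 𝔏₂[U] ≡ 0` for HOMOGENEOUS blow-downs with a `log`-modulated pressure.  This file proves the `𝔏₁` conjunct
— for ANY `C²` blow-down limit, homogeneous or not, whatever the pressure — which is exactly the first-law hypothesis
`∀ x ≠ x₀, horizonL1 U x₀ x = 0` of the conjecture `HorizonTowerZonality`.  The `𝔏₂` conjunct (second time derivative, far-field
pressure) is NOT touched.

## Proof

1. ORDER ONE IN TIME.  On a short window `[t₀, t₀ + ε/2) ⊆ S` the solution restricts (`IsClassicalNSSolutionOn.mono`,
   `uniqueDiffOn_Ico`), and eng-4 g3's `LoopLaw.firstOrderLawOfUnthreadedEvolution` (the K-bridge of the «linear-loop-law» card)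
   gives the vanishing of the order-one threading coefficient at `t₀`: `c₁(x) := ⟪x − x₀, curl(ω × u)(t₀, x)⟫ = 0` for all `x`.
2. SCALING.  For `wₖ z := u(t₀, x₀ + λₖ z)`: `curl wₖ(z) = λₖ (curl w)(xₖ)`, `xₖ = x₀ + λₖ z`, so `curl wₖ × wₖ = λₖ G(x₀ + λₖ ·)` with
   `G = ω × u`, and `curl(curl wₖ × wₖ)(z) = λₖ² (curl G)(xₖ)`; hence `⟪z, curl(curl wₖ × wₖ)(z)⟫ = λₖ c₁(xₖ) = 0` for every `k`.
3. LIMIT.  Orders `0, 1, 2` of the blow-down convergence on the compact `{z}` give `wₖ z → U z`, `Dwₖ(z) → DU(z)` and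
   `D²wₖ(z) → D²U(z)` (operator norm); hence `curl wₖ z → curl U z`, `D(curl wₖ)(z) = curlCLM ∘ D²wₖ(z) → D(curl U)(z)`, and both
   divergences converge; the expansion `curl(a × b) = Da[b] − (div a) b + (div b) a − Db[a]` (Literature `curl_cross_apply`) then
   passes `⟪z, curl(curl wₖ × wₖ)(z)⟫ = 0` to the limit: `⟪z, curl(curl U × U)(z)⟫ = 0`, i.e. `𝔏₁[U](z) = 0` (`U × curl U = −(curl U × U)`).

HONEST FRAME: information-grade, about the scale-free far field of hypothetical unthreaded counterexamples; it discharges the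
first-law hypothesis of `HorizonTowerZonality` for actual blow-downs but proves no zonality and no Liouville theorem;
`PoloidalLiouville` (1222) and NS regularity stay OPEN.

## References
* planner ns-idea-15, `Cruxes/PoloidalLiouville/HorizonTowerSketch.lean` (`OrderTwoHorizonLawBlowdown`, `HorizonTowerZonality`,
  `IsBlowdownLimit`); «linear-loop-law» card (`FirstOrderLawOfUnthreadedEvolution`, landed p678066).
* A. J. Majda, A. L. Bertozzi, *Vorticity and Incompressible Flow* (CUP 2002), §1.1, §2.1. [MajdaBertozziCUP2002]
-/

-- the summit and its single problem share the name (D-0017 nested layout)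
set_option linter.dupNamespace false

noncomputable section

namespace Summit.NavierStokesRegularity.NavierStokesRegularity.Theorems.PoloidalLiouville.HorizonTower

open Set Function Filter Topology Metric
open scoped Topology RealInnerProductSpace Laplacian ContDiff
open Literature.Analysis.FluidPDE

/-- **THE ORDER-ONE HORIZON LAW, BLOW-DOWN FORM.**  Let `(u, p)` be a classical Navier–Stokes solution (`ν = 1`, no force) on an
open set of times `S ∋ t₀`, unthreaded about `x₀` at every time of `S` (`threadingFlux u x₀ t x = 0`).  If the slice `u t₀` and the
pressure `p t₀` have a blow-down limit `(U, P₀)` about `x₀` in the sense of `IsBlowdownLimit`, with `U ∈ C²(ℝ³ ∖ {0})`, then the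
ORDER-ONE HORIZON LAW annihilates the horizon profile: `horizonL1 U 0 y = 0` for every `y ≠ 0`.  (No homogeneity of `U`, no
decay rate; the `𝔏₂` half of `OrderTwoHorizonLawBlowdown` is NOT touched.)  Mechanism: the order-one threading coefficient
`c₁(x) = ⟪x − x₀, curl(ω × u)(t₀, x)⟫` vanishes identically (`LoopLaw.firstOrderLawOfUnthreadedEvolution`, applied on a short window
`[t₀, t₁) ⊆ S`), and in the blow-down variables `Uₖ z = u(t₀, x₀ + λₖ z)` one has
`⟪z, curl(curl Uₖ × Uₖ)(z)⟫ = λₖ · c₁(x₀ + λₖ z) = 0`; orders `0, 1, 2` of the blow-down convergence on the compact `{z}` pass this to `U`. -/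
theorem orderOneHorizonLawBlowdown (S : Set ℝ) (u : ℝ → E3 → E3) (p : ℝ → E3 → ℝ) (x₀ : E3) (t₀ : ℝ)
    (U : E3 → E3) (P₀ : E3 → ℝ) (hS : IsOpen S) (ht₀ : t₀ ∈ S) (hNS : IsClassicalNSSolutionOn S 1 0 u p)
    (hF : ∀ t ∈ S, ∀ x, threadingFlux u x₀ t x = 0) (hU : ContDiffOn ℝ 2 U {0}ᶜ)
    (hbd : IsBlowdownLimit (u t₀) (p t₀) x₀ U P₀) :
    ∀ y : E3, y ≠ 0 → horizonL1 U 0 y = 0 := by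
  obtain ⟨lam, -, -, hlimV, -⟩ := hbd
  have hopen : IsOpen ({0}ᶜ : Set E3) := isOpen_compl_singleton
  /- the slice at `t₀` and its regularity -/
  set w : E3 → E3 := u t₀ with hw
  have hinS : ∀ x : E3, (t₀, x) ∈ S ×ˢ (univ : Set E3) := fun x => ⟨ht₀, mem_univ _⟩
  have hw3 : ContDiff ℝ 3 w := by
    have h := hNS.smooth_velocity.comp_contDiff (contDiff_const.prodMk contDiff_id) hinS
    exact h.of_le (by norm_cast)
  have hw2 : ContDiff ℝ 2 w := hw3.of_le (by norm_cast)
  have hwd : ∀ x, DifferentiableAt ℝ w x := fun x => hw2.differentiable (by norm_cast) x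
  have hDwd : ∀ x, DifferentiableAt ℝ (fderiv ℝ w) x := fun x =>
    (hw2.fderiv_right (m := 1) (by norm_cast)).differentiable (by simp) x
  have hcurlw : ContDiff ℝ 1 (curl w) := contDiff_curl (n := 1) (by exact_mod_cast hw2)
  have hcurlwd : ∀ x, DifferentiableAt ℝ (curl w) x := fun x => hcurlw.differentiable (by simp) x
  /- (1) the order-one threading coefficient vanishes at `t₀`: `⟪x − x₀, curl(ω × u)(x)⟫ = 0` -/
  have hc1 : ∀ x : E3, inner ℝ (x - x₀) (curl (fun z => cross (curl w z) (w z)) x) = 0 := by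
    obtain ⟨ε, hε, hball⟩ := Metric.isOpen_iff.mp hS t₀ ht₀
    have hsub : Ico t₀ (t₀ + ε / 2) ⊆ S := by
      intro t ht
      apply hball
      rw [Metric.mem_ball, Real.dist_eq, abs_lt]
      constructor <;> linarith [ht.1, ht.2]
    have hsol := hNS.mono hsub (uniqueDiffOn_Ico t₀ (t₀ + ε / 2))
    have hF' : ∀ t ∈ Ioo t₀ (t₀ + ε / 2), ∀ x : E3, inner ℝ (curl (u t) x) (x - x₀) = 0 :=
      fun t ht x => hF t (hsub ⟨ht.1.le, ht.2⟩) x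
    exact LoopLaw.firstOrderLawOfUnthreadedEvolution u p x₀ t₀ (t₀ + ε / 2) (by linarith) hsol hF'
  /- the rescaled slices `wₖ y = w (x₀ + λₖ y)` and their derivatives -/
  set Vk : ℕ → E3 → E3 := fun k y => w (x₀ + lam k • y) with hVk
  have hA : ∀ (k : ℕ) (y : E3), HasFDerivAt (fun z : E3 => x₀ + lam k • z) (lam k • ContinuousLinearMap.id ℝ E3) y :=
    fun k y => ((hasFDerivAt_id y).const_smul (lam k)).const_add x₀
  have hAC : ∀ k, ContDiff ℝ 2 (fun y : E3 => x₀ + lam k • y) := fun k =>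
    contDiff_const.add (contDiff_id.const_smul (lam k))
  have hVkC : ∀ k, ContDiff ℝ 2 (Vk k) := fun k => hw2.comp (hAC k)
  have hDVk : ∀ (k : ℕ) (y : E3), HasFDerivAt (Vk k) (lam k • fderiv ℝ w (x₀ + lam k • y)) y := by
    intro k y
    have h := (hwd (x₀ + lam k • y)).hasFDerivAt.comp y (hA k y)
    have e : (fderiv ℝ w (x₀ + lam k • y)).comp (lam k • ContinuousLinearMap.id ℝ E3)
        = lam k • fderiv ℝ w (x₀ + lam k • y) := by
      ext v; simp
    rw [e] at h
    exact h
  have hcurlVk : ∀ (k : ℕ) (y : E3), curl (Vk k) y = lam k • curl w (x₀ + lam k • y) := by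
    intro k y
    rw [curl_eq_curlCLM, (hDVk k y).fderiv, map_smul, ← curl_eq_curlCLM]
  /- (2) exact vanishing in the blow-down variables: `⟪z, curl(curl wₖ × wₖ)(z)⟫ = λₖ c₁(x₀ + λₖ z) = 0` -/
  set G : E3 → E3 := fun x => cross (curl w x) (w x) with hG
  have hGd : ∀ x, DifferentiableAt ℝ G x := fun x =>
    (hasFDerivAt_cross (hcurlwd x).hasFDerivAt (hwd x).hasFDerivAt).differentiableAt
  have hzero : ∀ (k : ℕ) (z : E3), inner ℝ z (curl (fun y => cross (curl (Vk k) y) (Vk k y)) z) = 0 := by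
    intro k z
    have hfun : (fun y => cross (curl (Vk k) y) (Vk k y)) = fun y => lam k • G (x₀ + lam k • y) := by
      funext y
      rw [hcurlVk k y]
      show cross (lam k • curl w (x₀ + lam k • y)) (w (x₀ + lam k • y)) = lam k • cross (curl w (x₀ + lam k • y)) (w (x₀ + lam k • y))
      rw [Tao2016.cross_smul_left]
    have hGA : HasFDerivAt (fun y : E3 => G (x₀ + lam k • y))
        ((fderiv ℝ G (x₀ + lam k • z)).comp (lam k • ContinuousLinearMap.id ℝ E3)) z := by
      have h := (hGd (x₀ + lam k • z)).hasFDerivAt.comp z (hA k z)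
      exact h
    have hcurl : curl (fun y => lam k • G (x₀ + lam k • y)) z = (lam k * lam k) • curl G (x₀ + lam k • z) := by
      rw [curl_const_smul hGA.differentiableAt, curl_eq_curlCLM, hGA.fderiv, curl_eq_curlCLM]
      have e : (fderiv ℝ G (x₀ + lam k • z)).comp (lam k • ContinuousLinearMap.id ℝ E3)
          = lam k • fderiv ℝ G (x₀ + lam k • z) := by
        ext v; simp
      rw [e, map_smul, smul_smul]
    rw [hfun, hcurl, inner_smul_right]
    have h := hc1 (x₀ + lam k • z)
    rw [add_sub_cancel_left, real_inner_smul_left] at h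
    -- `h : lam k * ⟪z, curl G xₖ⟫ = 0`
    rw [mul_assoc, h, mul_zero]
  /- (3) pointwise limits at `z ≠ 0` from the blow-down convergence on the compact `{z}` -/
  have hptV : ∀ z : E3, z ≠ 0 → ∀ j ≤ 6,
      Tendsto (fun k => ‖iteratedFDeriv ℝ j (fun y : E3 => w (x₀ + lam k • y) - U y) z‖) atTop (𝓝 0) := by
    intro z hz j hj
    have h0 : (0 : E3) ∉ ({z} : Set E3) := by
      rw [Set.mem_singleton_iff]; exact fun h => hz h.symm
    have h := hlimV {z} isCompact_singleton h0 j hj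
    simpa only [Set.image_singleton, csSup_singleton] using h
  have happly : ∀ {L : ℕ → E3 →L[ℝ] E3} {v : ℕ → E3} {L₀ : E3 →L[ℝ] E3} {v₀ : E3},
      Tendsto L atTop (𝓝 L₀) → Tendsto v atTop (𝓝 v₀) → Tendsto (fun k => L k (v k)) atTop (𝓝 (L₀ v₀)) := by
    intro L v L₀ v₀ hL hv
    have hc : Continuous fun q : (E3 →L[ℝ] E3) × E3 => q.1 q.2 := isBoundedBilinearMap_apply.continuous
    exact (hc.tendsto (L₀, v₀)).comp (hL.prodMk_nhds hv)
  set e : OrthonormalBasis (Fin 3) ℝ E3 := EuclideanSpace.basisFun (Fin 3) ℝ with he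
  intro z hz
  have hU2z : ContDiffAt ℝ 2 U z := (hU z hz).contDiffAt (hopen.mem_nhds hz)
  have hUd : DifferentiableAt ℝ U z := hU2z.differentiableAt (by norm_num)
  have hDUd : DifferentiableAt ℝ (fderiv ℝ U) z :=
    (hU2z.fderiv_right (m := 1) (by norm_cast)).differentiableAt (by simp)
  have hcurlUd : DifferentiableAt ℝ (curl U) z := by
    rw [curl_eq_curlCLM_comp]
    exact curlCLM.differentiableAt.comp z hDUd
  have hL0 : Tendsto (fun k => Vk k z) atTop (𝓝 (U z)) := by
    rw [tendsto_iff_norm_sub_tendsto_zero]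
    have h := hptV z hz 0 (by norm_num)
    simpa only [norm_iteratedFDeriv_zero] using h
  have hL1 : Tendsto (fun k => fderiv ℝ (Vk k) z) atTop (𝓝 (fderiv ℝ U z)) := by
    rw [tendsto_iff_norm_sub_tendsto_zero]
    have h := hptV z hz 1 (by norm_num)
    refine h.congr fun k => ?_
    rw [← norm_iteratedFDeriv_fderiv, norm_iteratedFDeriv_zero,
      fderiv_fun_sub ((hDVk k z).differentiableAt) hUd]
  -- second derivatives converge in operator norm
  have hL2 : Tendsto (fun k => fderiv ℝ (fderiv ℝ (Vk k)) z) atTop (𝓝 (fderiv ℝ (fderiv ℝ U) z)) := by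
    refine (tendsto_iff_norm_sub_tendsto_zero (E := E3 →L[ℝ] E3 →L[ℝ] E3)).2 ?_
    have h := hptV z hz 2 (by norm_num)
    refine h.congr fun k => ?_
    have hDVkd : DifferentiableAt ℝ (fderiv ℝ (Vk k)) z :=
      ((hVkC k).fderiv_right (m := 1) (by norm_cast)).differentiable (by simp) z
    -- `D(wₖ − U) = Dwₖ − DU` near `z`
    have hev : fderiv ℝ (fun y : E3 => w (x₀ + lam k • y) - U y) =ᶠ[𝓝 z] fun y => fderiv ℝ (Vk k) y - fderiv ℝ U y := by
      filter_upwards [hopen.mem_nhds hz] with y hy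
      have hUy : DifferentiableAt ℝ U y := ((hU y hy).contDiffAt (hopen.mem_nhds hy)).differentiableAt (by norm_num)
      exact fderiv_fun_sub ((hDVk k y).differentiableAt) hUy
    rw [← norm_iteratedFDeriv_fderiv, ← norm_iteratedFDeriv_fderiv, norm_iteratedFDeriv_zero, hev.fderiv_eq,
      fderiv_fun_sub hDVkd hDUd]
  -- hence the curl, its derivative, and both divergences converge
  have hLcurl : Tendsto (fun k => curl (Vk k) z) atTop (𝓝 (curl U z)) := by
    simp only [curl_eq_curlCLM]
    exact (curlCLM.continuous.tendsto _).comp hL1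
  have hDcurl : ∀ (f : E3 → E3), DifferentiableAt ℝ (fderiv ℝ f) z →
      fderiv ℝ (curl f) z = curlCLM.comp (fderiv ℝ (fderiv ℝ f) z) := by
    intro f hf
    rw [curl_eq_curlCLM_comp]
    exact (curlCLM.hasFDerivAt.comp z hf.hasFDerivAt).fderiv
  have hLDcurl : Tendsto (fun k => fderiv ℝ (curl (Vk k)) z) atTop (𝓝 (fderiv ℝ (curl U) z)) := by
    have hDVkd : ∀ k, DifferentiableAt ℝ (fderiv ℝ (Vk k)) z := fun k =>
      ((hVkC k).fderiv_right (m := 1) (by norm_cast)).differentiable (by simp) z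
    have hcomp : Continuous fun L : E3 →L[ℝ] (E3 →L[ℝ] E3) => (curlCLM : (E3 →L[ℝ] E3) →L[ℝ] E3).comp L :=
      ((ContinuousLinearMap.compL ℝ E3 (E3 →L[ℝ] E3) E3) curlCLM).continuous
    have h := (hcomp.tendsto _).comp hL2
    rw [← hDcurl U hDUd] at h
    refine h.congr fun k => ?_
    show curlCLM.comp (fderiv ℝ (fderiv ℝ (Vk k)) z) = fderiv ℝ (curl (Vk k)) z
    rw [hDcurl (Vk k) (hDVkd k)]
  have hLdiv : Tendsto (fun k => VectorCalculus.divergence (Vk k) z) atTop (𝓝 (VectorCalculus.divergence U z)) := by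
    simp only [divergence_eq_sum_inner_fderiv e]
    exact tendsto_finsetSum _ fun i _ => tendsto_const_nhds.inner (happly hL1 tendsto_const_nhds)
  have hLdivcurl : Tendsto (fun k => VectorCalculus.divergence (curl (Vk k)) z) atTop
      (𝓝 (VectorCalculus.divergence (curl U) z)) := by
    simp only [divergence_eq_sum_inner_fderiv e]
    exact tendsto_finsetSum _ fun i _ => tendsto_const_nhds.inner (happly hLDcurl tendsto_const_nhds)
  /- (4) the expanded curl of the cross product converges, and vanishes identically along the sequence -/
  have hexpand : ∀ (f : E3 → E3), DifferentiableAt ℝ (curl f) z → DifferentiableAt ℝ f z →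
      curl (fun y => cross (curl f y) (f y)) z
        = fderiv ℝ (curl f) z (f z) - VectorCalculus.divergence (curl f) z • f z
          + VectorCalculus.divergence f z • curl f z - fderiv ℝ f z (curl f z) :=
    fun f hcf hf => curl_cross_apply hcf hf
  have hcurlVkd : ∀ k, DifferentiableAt ℝ (curl (Vk k)) z := fun k => by
    rw [curl_eq_curlCLM_comp]
    exact curlCLM.differentiableAt.comp z
      (((hVkC k).fderiv_right (m := 1) (by norm_cast)).differentiable (by simp) z)
  have hlim : Tendsto (fun k => inner ℝ z (curl (fun y => cross (curl (Vk k) y) (Vk k y)) z)) atTop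
      (𝓝 (inner ℝ z (curl (fun y => cross (curl U y) (U y)) z))) := by
    rw [hexpand U hcurlUd hUd]
    have h := (((happly hLDcurl hL0).sub (hLdivcurl.smul hL0)).add (hLdiv.smul hLcurl)).sub (happly hL1 hLcurl)
    refine (tendsto_const_nhds.inner h).congr fun k => ?_
    rw [hexpand (Vk k) (hcurlVkd k) ((hDVk k z).differentiableAt)]
  have hvan : inner ℝ z (curl (fun y => cross (curl U y) (U y)) z) = 0 :=
    tendsto_nhds_unique hlim (tendsto_const_nhds.congr fun k => (hzero k z).symm)
  /- (5) `𝔏₁[U](z) = ‖z‖ ⟪z, curl(U × curl U)(z)⟫ = −‖z‖ ⟪z, curl(curl U × U)(z)⟫ = 0` -/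
  have hneg : (fun y => cross (U y) (curl U y)) = fun y => -cross (curl U y) (U y) := by
    funext y; rw [cross_swap]
  unfold horizonL1
  rw [sub_zero, hneg, curl_neg, inner_neg_right, hvan, neg_zero, mul_zero]

end Summit.NavierStokesRegularity.NavierStokesRegularity.Theorems.PoloidalLiouville.HorizonTower

end
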